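import Literature.MathematicalPhysics.QuantumFieldTheory.Balaban1983to89.B9Eq3126EnergyBallTowerTwoBackgrounds
import Literature.MathematicalPhysics.QuantumFieldTheory.Balaban1983to89.B11Eq117LetterDefectsTwoBackgrounds

/-!
# `Balaban1983to89.B11Eq117LetterDefectsTowerTwoBackgrounds` — T. Bałaban, *The variational problem and background fields in renormalization group method
# for lattice gauge theories*, Commun. Math. Phys. **102** (1985) 277–309 [Balaban1985Variational] (115)∕(117) pp. 294–295 with T. Bałaban, *Propagators
# for lattice gauge theories in a background field*, Commun. Math. Phys. **99** (1985) 389–434 [Balaban1985BackgroundPropagators] Thm 3.4 p. 400, (3.126)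
# p. 420, (3.153) p. 426: THE `k`-LEVEL CHART LETTERS `𝔊_k`, `H_k` READ ACROSS THE (115) NORMS OF TWO SMALL BACKGROUNDS `U`, `V` ON PRINT's DIAGONAL — the
# letter defects `K_ι`, `δ_G`, `δ_A` of `B11Eq120SolutionContinuity` BETWEEN `U` AND `V` one storey up, with the `L²` Lipschitz letters LEVEL-FREE (the
# two-background energy junction `B9Eq3126EnergyBallTowerTwoBackgrounds`) and (117)'s finite-lattice factor DISPLAYED as the one remaining product;
# `∃ α₀ δ₀ K` BEFORE EVERY BINDER (the two-background («(b3)») twin of the NE9 owner's `B11Eq117LetterDefectsTowerDiagonal`, there `V = 1`, `δ = α`)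

statement-level skeleton of published theorems with citation tags; proofs where landed; nothing here is a claim about the Yang–Mills mass gap

PDF held: `paper:balaban1985-cmp102-variational-background` (journal page = PDF page + 276), pp. 285, 293–295, 305; `paper:balaban1985-cmp99-background-propagators`
(journal page = PDF page + 388), pp. 391, 400, 420, 426 — through the quotations of `B11Eq117LetterDefects` (NE9 owner gen 82) and of the host.

CITATION HEADER (lean-in-tree rule 2026-08-18).  Audit cell `pub-balaban`, sub-cell `t4`, NE9 crux team (2): LEAF PROVER 04 (`b2b-balaban-t4-ne9-formalise-leaf-04`
gen 78), INTENT-2 — the OWNER's offer (journal `CLAIMS.log` l.51017: «the k-level two-background version is YOURS»).  WHY: NE9 compares the `k`-th-step chart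
letters of TWO coupling histories, i.e. at two small backgrounds `U`, `V`; the k-level chart-continuity chain between `U` and `V` ((B″)₂-k ∕ (Z)₂-k, one storey
above this lineage's one-step `B11Eq174ChartContinuityTwoBackgrounds`) takes exactly the three inputs produced here, the residual non-uniformity isolated in
(117)'s explicit product as in the host.

THE PRINT (verbatim).  [Balaban1985Variational] p. 295 L7–L9: *«By Theorem 3.13 of [5] the norm max{| |_(−1), |∇ |_(−2)} of the transformation can be
estimated by [(117)] if ε₄ + B₀|B| ≤ a₃»*; [Balaban1985BackgroundPropagators] p. 400, Thm 3.4: *«G(U) is an analytic function of U′ on the space of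
configurations U′ satisfying (3.35)»* — read in the cell at a fixed lattice as Lipschitz continuity of the letters between two points `U`, `V` of the
small-field ball, here at `k = n+1` averaging levels and in the ENERGY currency; (3.3) p. 391: the covariant derivative `∇_U` (two conjugations by `U(b)`).

WHAT IS PROVED (sorry-free; no `def`, no `Prop` placeholder; no inequality of the paper asserted hypothesis-free).
* **`exists_letter_defects_tower_two_backgrounds_closed`** — there are `α₀, δ₀, K > 0` (`K` closed in `(d, a, L, M_φ, M_φ′, r, C_τ, ρ_w)`) such that for
  every `n` (`3 ≤ L^{n+1}`), `η > 0` (`ηL^{n+1} = 1`), `c₀, c₁` (`c₀(L^{n+1})^d = c₁`, `|η|^d∕c₀ ≤ ρ_w`), `m`, ANY level maps `lev₀, lev_B, lev₁`, every pair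
  `U`, `V` of backgrounds of E162's data, unitary, `U1`-valued, in the windows `‖X(b) − 1‖ ≤ αη`, `‖X(∂p) − 1‖ ≤ αη²`, `‖X̄^j(b) − 1‖ ≤ ε_j ≤ αr^j`, CLOSE
  (`‖U(b) − V(b)‖ ≤ δη`, `‖U(∂p) − V(∂p)‖ ≤ δη²`, `‖Ū^j(b) − V̄^j(b)‖ ≤ δ_j ≤ δr^j`; `0 ≤ α ≤ α₀`, `0 ≤ δ ≤ δ₀`), and ANY witnesses `hposU hposV hQU hQV`,
  with `ι = ι_{∇_U → ∇_V}` the jet identity: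
  (K_ι) `‖ι f‖ ≤ (1 + w̄₁·(2|η|⁻¹·δη)·w̲₀⁻¹)‖f‖` (the closeness window enters as `2|η|⁻¹·δη` — level-free `2δ` on the diagonal up to the weights);
  (δ_G) `‖ι(𝔊_k(U)f) − 𝔊_k(V)f‖_(115),∇_V ≤ K·V_G·δ·|f|_(−3)`; (δ_A) `‖ι(H_k(U)B) − H_k(V)B‖_(115),∇_V ≤ K·V_H·δ·|B|_(−0)`, with the (117) products
  `V_G = max(w̄₀, w̄₁·2|η|⁻¹)·(M_φ√(c₀#β_k)M_φ′∕√c₀)·w̲₃⁻¹`, `V_H = max(w̄₀, w̄₁·2|η|⁻¹)·(M_φ√(c₁#β_m)M_φ′∕√c₀)·w̲_B⁻¹` DISPLAYED verbatim (as in the host).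
  MECHANISM: the junction's mass rows `[𝔊].1`, `[H].1`; `B11Eq117LetterDefects` §1–§3 (`norm_jetId_le`, `norm_toCLM115_readFun_sub_le`,
  `norm_H1CLM_sub_le`, `jetId_frakG_eq_toCLM115_readFun`, `frakG_eq_toCLM115_readFun`) with `‖∇_V‖ ≤ 2|η|⁻¹` (`norm_nabla115_le`, unit bounds from
  `V(b) ∈ U1`) and `‖∇_V − ∇_U‖ ≤ 2|η|⁻¹·δη` (this lineage's `B11Eq117LetterDefectsTwoBackgrounds.norm_nabla115_sub_le`, gen 73).
HONEST SCOPE.  [folklore] composition by name, 0 new estimate; the (117) factors ARE load-bearing finite-lattice numbers (level AND volume) — NOT print's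
lattice-uniform `B₀` (Thm 3.13's decay); FIRST order between two small backgrounds only (no analyticity in `U`); the chain's `laplaceAk` (print's `G₀`-slot,
D-ne9p1-g87-1) — NOT the Δ_π letters; the small-field WINDOWS, the level and closeness profiles, E162's data, unitarity + the trace letters, `ρ_w` and the
witnesses stay HYPOTHESES; the k-level chart between `U` and `V` is NOT here — its three displayed inputs are.  NOT summit progress (cell pub-balaban: NE9
NOT PRINTED ∕ NOT PROVED; «NE9 ⇐ the named binders»; row WALLED ON A MODEL (O-NE9-1; #5 UNRULED); spine PROVED 0∕9; rung (B)+1 finite T⁴ — NOT infinite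
volume, NOT mass gap, NOT BetaPertH, NOT Clay).  HONEST DEPENDENCY (cell line): continuum YM on T⁴ ⇐ BetaPertH ∧ nine spine estimates (0/9 proved); BetaPertH
⇐ (D1) ∧ (D4) ∧ CAP+tail; G-an2-4 gates asym, D1 and NE2/3/4.  NEW file; nothing modified.  Net new unproved facts: 0.
-/

noncomputable section

open scoped InnerProductSpace ComplexConjugate BigOperators

namespace Literature.MathematicalPhysics.QuantumFieldTheory.Balaban1983to89.B11Eq117LetterDefectsTowerTwoBackgrounds

open B4Sect5Torus (TSite)
open B9SectCLatticeCarrier (Bond)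
open B11Eq103H1Complex (SiteL2K BondL2K covDerivL2K covDivL2K G1LatticeK H1LatticeK frakGLatticeK KinvLatticeK H1LatticeCLM frakGLatticeCLM H1CLM
  readFun)
open B11Eq115Space (NegSize Space115 levWeight NegSup)
open B11Eq111FrakG (nabla115 jetLinearEquiv toCLM115)
open B11Eq117TransformationNorm (norm_nabla115_le)
open B11Eq117LetterDefects (norm_jetId_le norm_toCLM115_readFun_sub_le norm_H1CLM_sub_le jetId_frakG_eq_toCLM115_readFun frakG_eq_toCLM115_readFun)
open B11Eq117LetterDefectsTwoBackgrounds (norm_nabla115_sub_le)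
open B9Eq310HessianOperator (adTransportW covCurlL2K)
open B9Eq310DeltaPrime (plaqHolU)
open B9Eq315QTorus (perCfg cornerSite)
open B9Eq315QTower (towerP UlevOf)
open B9Eq326OperatorTower (laplaceAk QkW RofUk)
open B7Prop1Explicit (U1 Wcx boxVec)
open B9Eq3126EnergyBallTowerTwoBackgrounds (exists_energy_ball_two_backgrounds_closed)

variable {d : ℕ} (hd : 1 ≤ d) (L : ℕ) [NeZero L] (hL : 1 ≤ L)
  {𝔸 : Type*} [NormedRing 𝔸] [NormedAlgebra ℂ 𝔸] [CompleteSpace 𝔸] [NormOneClass 𝔸] [StarRing 𝔸] [NormedStarGroup 𝔸] [StarModule ℂ 𝔸]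
  [FiniteDimensional ℂ 𝔸]
  {W : Type*} [NormedAddCommGroup W] [InnerProductSpace ℂ W] [FiniteDimensional ℂ W] (φ : W ≃ₗ[ℂ] 𝔸)
  {Mφ Mφ' : ℝ} (hMφ : 0 ≤ Mφ) (hMφ' : 0 ≤ Mφ') (hφ : ∀ w, ‖φ w‖ ≤ Mφ * ‖w‖) (hφ' : ∀ X, ‖φ.symm X‖ ≤ Mφ' * ‖X‖)
  {a : ℝ} (ha : 0 < a) {r : ℝ} (hr0 : 0 ≤ r) (hr1 : r < 1)
  (τ : 𝔸 →ₗ[ℂ] ℂ) {Cτ : ℝ} (hτ : ∀ X, ‖τ X‖ ≤ Cτ * ‖X‖) (hCτ : 0 ≤ Cτ) {ρw : ℝ} (hρw : 0 ≤ ρw)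
  (hτ₁ : ∀ X : 𝔸, τ (star X) = conj (τ X)) (hτ₂ : ∀ X Y : 𝔸, τ (X * Y) = τ (Y * X))
  (hφτ : ∀ X Y : 𝔸, ⟪φ.symm X, φ.symm Y⟫_ℂ = τ (star X * Y))

include hd hMφ hMφ' hφ hφ' ha hr0 hr1 hτ hCτ hρw hτ₁ hτ₂ hφτ

set_option maxHeartbeats 800000 in
set_option maxRecDepth 8192 in
/-- **THE `k`-LEVEL LETTER DEFECTS BETWEEN TWO SMALL BACKGROUNDS ON THE DIAGONAL, (117)'s FACTOR ISOLATED** — see the module header: `∃ α₀ δ₀ K > 0` (`K`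
level-free) before every binder; then for unitary `U`, `V` in the three windows, `δ`-close in bonds ∕ plaquettes ∕ level averages, ANY level maps and ANY
witnesses: (K_ι) the jet identity `∇_U → ∇_V` is bounded by `1 + w̄₁·(2|η|⁻¹·δη)·w̲₀⁻¹`; (δ_G) `‖ι(𝔊_k(U)f) − 𝔊_k(V)f‖ ≤ K·V_G·δ·‖f‖`; (δ_A)
`‖ι(H_k(U)B) − H_k(V)B‖ ≤ K·V_H·δ·‖B‖`, the (117) products `V_G`, `V_H` displayed.  The two-background energy junction read through `B11Eq117LetterDefects`
§1–§3; 0 new estimate. [folklore]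
[cite: Balaban1985Variational, (103) p.293, (110)–(111) p.294, (115) p.294, (117) p.295, (174) p.305; Balaban1985BackgroundPropagators, (3.3) p.391, Thm 3.4 p.400, (3.126) p.420, (3.153) p.426] -/
theorem exists_letter_defects_tower_two_backgrounds_closed [Fact (0 < (L : ℝ))] :
    ∃ α₀ δ₀ K : ℝ, 0 < α₀ ∧ 0 < δ₀ ∧ 0 < K ∧ ∀ (n : ℕ) (η : ℝ) [Fact (0 < η)], η * (L : ℝ) ^ (n + 1) = 1 → 3 ≤ L ^ (n + 1) →
      ∀ (c₀ c₁ : ℝ) [Fact (0 < c₀)] [Fact (0 < c₁)], c₀ * ((L : ℝ) ^ (n + 1)) ^ d = c₁ → |η| ^ d / c₀ ≤ ρw →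
      ∀ (m : Fin d → ℕ) [∀ i, NeZero (m i)] (lev₀ : Bond d (towerP L m (n + 1)) → ℕ) (levB : Bond d m → ℕ)
        (lev₁ : Bond d (towerP L m (n + 1)) × Fin d → ℕ)
        (U V : Bond d (towerP L m (n + 1)) → 𝔸ˣ) (αU : ℕ → ℝ) (hα1 : ∀ j, αU j ≤ 1 / 64)
        (hU1 : ∀ (j : ℕ) (x : B7Prop1Explicit.Site d) (κ : Fin d), perCfg (towerP L m (j + 1)) (UlevOf L m (n + 1) U j) x κ ∈ U1 𝔸)
        (hreg : ∀ (j : ℕ) (y : TSite d (towerP L m j)) (κ : Fin d) (r : Fin d → Fin L),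
          ‖((Wcx L (perCfg (towerP L m (j + 1)) (UlevOf L m (n + 1) U j)) (cornerSite L y) κ (boxVec L r) : 𝔸ˣ) : 𝔸) - 1‖ ≤ αU j)
        (αV : ℕ → ℝ) (hα1' : ∀ j, αV j ≤ 1 / 64)
        (hV1 : ∀ (j : ℕ) (x : B7Prop1Explicit.Site d) (κ : Fin d), perCfg (towerP L m (j + 1)) (UlevOf L m (n + 1) V j) x κ ∈ U1 𝔸)
        (hregV : ∀ (j : ℕ) (y : TSite d (towerP L m j)) (κ : Fin d) (r : Fin d → Fin L),
          ‖((Wcx L (perCfg (towerP L m (j + 1)) (UlevOf L m (n + 1) V j)) (cornerSite L y) κ (boxVec L r) : 𝔸ˣ) : 𝔸) - 1‖ ≤ αV j),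
        (∀ j, αV j ≤ 1 / 128) →
      ∀ (εU : ℕ → ℝ), (∀ j, 0 ≤ εU j) → (∀ (j : ℕ) (b : Bond d (towerP L m (j + 1))), ‖(UlevOf L m (n + 1) U j b : 𝔸) - 1‖ ≤ εU j) →
        (∀ (j : ℕ) (b : Bond d (towerP L m (j + 1))), ‖(UlevOf L m (n + 1) V j b : 𝔸) - 1‖ ≤ εU j) →
      ∀ (δUV : ℕ → ℝ), (∀ j, 0 ≤ δUV j) →
        (∀ (j : ℕ) (b : Bond d (towerP L m (j + 1))), ‖(UlevOf L m (n + 1) U j b : 𝔸) - (UlevOf L m (n + 1) V j b : 𝔸)‖ ≤ δUV j) →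
      ∀ {α δ : ℝ}, 0 ≤ α → α ≤ α₀ → 0 ≤ δ → δ ≤ δ₀ →
        (∀ b, star (U b : 𝔸) = (((U b)⁻¹ : 𝔸ˣ) : 𝔸)) → (∀ b, star (V b : 𝔸) = (((V b)⁻¹ : 𝔸ˣ) : 𝔸)) →
        (∀ b, U b ∈ U1 𝔸) → (∀ b, V b ∈ U1 𝔸) → (∀ b, ‖(U b : 𝔸) - 1‖ ≤ α * η) → (∀ b, ‖(V b : 𝔸) - 1‖ ≤ α * η) →
        (∀ p : B9SectCLatticeCarrier.Plaq d (towerP L m (n + 1)), ‖(plaqHolU U p : 𝔸) - 1‖ ≤ α * η ^ 2) →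
        (∀ p : B9SectCLatticeCarrier.Plaq d (towerP L m (n + 1)), ‖(plaqHolU V p : 𝔸) - 1‖ ≤ α * η ^ 2) →
        (∀ b, ‖(U b : 𝔸) - (V b : 𝔸)‖ ≤ δ * η) →
        (∀ p : B9SectCLatticeCarrier.Plaq d (towerP L m (n + 1)), ‖(plaqHolU U p : 𝔸) - (plaqHolU V p : 𝔸)‖ ≤ δ * η ^ 2) →
        (∀ j < n + 1, εU j ≤ α * r ^ j) → (∀ j, δUV j ≤ δ * r ^ j) →
        ∀ (hposU : ∀ x : BondL2K ℂ d (towerP L m (n + 1)) c₀ W, x ≠ 0 →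
            0 < RCLike.re ⟪x, laplaceAk L m n φ η U hL αU hα1 hU1 hreg τ (c₀ := c₀) (c₁ := c₁) a x⟫_ℂ)
          (hposV : ∀ x : BondL2K ℂ d (towerP L m (n + 1)) c₀ W, x ≠ 0 →
            0 < RCLike.re ⟪x, laplaceAk L m n φ η V hL αV hα1' hV1 hregV τ (c₀ := c₀) (c₁ := c₁) a x⟫_ℂ)
          (hQU : Function.Surjective (QkW L m n φ U hL αU hα1 hU1 hreg (c₀ := c₀) (c₁ := c₁)))
          (hQV : Function.Surjective (QkW L m n φ V hL αV hα1' hV1 hregV (c₀ := c₀) (c₁ := c₁))),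
        -- (K_ι) the jet identity `∇_U → ∇_V`
        (∀ f : Space115 (L : ℝ) η lev₀ lev₁ (nabla115 η U),
          ‖LinearMap.toContinuousLinearMap
              ((jetLinearEquiv (L : ℝ) η lev₀ lev₁ (nabla115 η V)).symm.toLinearMap ∘ₗ
                (jetLinearEquiv (L : ℝ) η lev₀ lev₁ (nabla115 η U)).toLinearMap) f‖ ≤
            (1 + (NegSup.wSup (levWeight (L : ℝ) η lev₁ 2) : ℝ) * (2 * ‖((η : ℂ))⁻¹‖ * (δ * η)) * NegSup.wInvSup (levWeight (L : ℝ) η lev₀ 1)) * ‖f‖) ∧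
        -- (δ_G) the `𝔊`-letter across the two norms
        (∀ f : NegSize (L : ℝ) η lev₀ 3 𝔸,
          ‖LinearMap.toContinuousLinearMap
              ((jetLinearEquiv (L : ℝ) η lev₀ lev₁ (nabla115 η V)).symm.toLinearMap ∘ₗ
                (jetLinearEquiv (L : ℝ) η lev₀ lev₁ (nabla115 η U)).toLinearMap)
              (frakGLatticeCLM (L := (L : ℝ)) (η := η) (lev₀ := lev₀) φ hposU hQU lev₁ (nabla115 η U) f) -
            frakGLatticeCLM (L := (L : ℝ)) (η := η) (lev₀ := lev₀) φ hposV hQV lev₁ (nabla115 η V) f‖ ≤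
            K * (max (NegSup.wSup (levWeight (L : ℝ) η lev₀ 1) : ℝ) (NegSup.wSup (levWeight (L : ℝ) η lev₁ 2) * (2 * ‖((η : ℂ))⁻¹‖)) *
              (Mφ * Real.sqrt (c₀ * Fintype.card (Bond d (towerP L m (n + 1)))) * Mφ' / Real.sqrt c₀) *
              NegSup.wInvSup (levWeight (L : ℝ) η lev₀ 3)) * δ * ‖f‖) ∧
        -- (δ_A) the `H₁`-letter across the two norms
        (∀ B : NegSize (L : ℝ) η levB 0 𝔸,
          ‖LinearMap.toContinuousLinearMap
              ((jetLinearEquiv (L : ℝ) η lev₀ lev₁ (nabla115 η V)).symm.toLinearMap ∘ₗ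
                (jetLinearEquiv (L : ℝ) η lev₀ lev₁ (nabla115 η U)).toLinearMap)
              (H1LatticeCLM (L := (L : ℝ)) (η := η) (lev₀ := lev₀) (levB := levB) φ hposU hQU lev₁ (nabla115 η U) B) -
            H1LatticeCLM (L := (L : ℝ)) (η := η) (lev₀ := lev₀) (levB := levB) φ hposV hQV lev₁ (nabla115 η V) B‖ ≤
            K * (max (NegSup.wSup (levWeight (L : ℝ) η lev₀ 1) : ℝ) (NegSup.wSup (levWeight (L : ℝ) η lev₁ 2) * (2 * ‖((η : ℂ))⁻¹‖)) *
              (Mφ * Real.sqrt (c₁ * Fintype.card (Bond d m)) * Mφ' / Real.sqrt c₀) *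
              NegSup.wInvSup (levWeight (L : ℝ) η levB 0)) * δ * ‖B‖) := by
  obtain ⟨α₀, δ₀, C, hα₀, hδ₀, hC, H⟩ := exists_energy_ball_two_backgrounds_closed hd L hL φ hMφ hMφ' hφ hφ' ha hr0 hr1 τ hτ hCτ hρw hτ₁ hτ₂ hφτ
  refine ⟨α₀, δ₀, C, hα₀, hδ₀, hC, ?_⟩
  intro n η _ hηL hL3 c₀ c₁ _ _ hw hρ m _ lev₀ levB lev₁ U V αU hα1 hU1 hreg αV hα1' hV1 hregV hα128 εU hεU hUε hVε δUV hδUV hLUV α δ hα0 hαle hδ0 hδle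
    hUst hVst hUb hVb hUη hVη hplU hplV hUV hpp hεg hδg hposU hposV hQU hQV
  obtain ⟨-, HF, HH⟩ := H n η hηL hL3 c₀ c₁ hw hρ m U V αU hα1 hU1 hreg αV hα1' hV1 hregV hα128 εU hεU hUε hVε δUV hδUV hLUV hα0 hαle hδ0 hδle
    hUst hVst hUb hVb hUη hVη hplU hplV hUV hpp hεg hδg hposU hposV hQU hQV
  -- the mass rows of the two Lipschitz groups
  have hG : ∀ x : BondL2K ℂ d (towerP L m (n + 1)) c₀ W, ‖frakGLatticeK hposU hQU x - frakGLatticeK hposV hQV x‖ ≤ (C * δ) * ‖x‖ :=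
    fun x => (HF x).1
  have hH : ∀ b : BondL2K ℂ d m c₁ W, ‖H1LatticeK hposU hQU b - H1LatticeK hposV hQV b‖ ≤ (C * δ) * ‖b‖ := fun b => (HH b).1
  have hCδ : 0 ≤ C * δ := mul_nonneg hC.le hδ0
  have hδη : 0 ≤ δ * η := mul_nonneg hδ0 (le_of_lt (Fact.out : 0 < η))
  -- the derivative letter at `V` and the defect of the derivative letters
  have hVb2 : ∀ b : Bond d (towerP L m (n + 1)), ‖(V b : 𝔸)‖ ≤ 1 ∧ ‖(((V b)⁻¹ : 𝔸ˣ) : 𝔸)‖ ≤ 1 := fun b => B7Prop1Explicit.mem_U1.1 (hVb b)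
  have hDV : ∀ g : Bond d (towerP L m (n + 1)) → 𝔸, ‖nabla115 η V g‖ ≤ (2 * ‖((η : ℂ))⁻¹‖) * ‖g‖ := fun g => norm_nabla115_le η _ hVb2 g
  refine ⟨fun f => ?_, fun f => ?_, fun B => ?_⟩
  · exact norm_jetId_le lev₁ (nabla115 η U) (nabla115 η V) (by positivity) (norm_nabla115_sub_le η U V hUb hVb hδη hUV) f
  · have e1 : LinearMap.toContinuousLinearMap
            ((jetLinearEquiv (L : ℝ) η lev₀ lev₁ (nabla115 η V)).symm.toLinearMap ∘ₗ
              (jetLinearEquiv (L : ℝ) η lev₀ lev₁ (nabla115 η U)).toLinearMap)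
            (frakGLatticeCLM (L := (L : ℝ)) (η := η) (lev₀ := lev₀) φ hposU hQU lev₁ (nabla115 η U) f) =
        toCLM115 (L := (L : ℝ)) (η := η) (lev₀ := lev₀) lev₁ (nabla115 η V)
          (readFun φ (fun _ => c₀) (fun _ => c₀) (frakGLatticeK hposU hQU)) f :=
      jetId_frakG_eq_toCLM115_readFun (L := (L : ℝ)) (η := η) (lev₀ := lev₀) φ lev₁ (nabla115 η U) (nabla115 η V)
        (G1LatticeK hposU) (QkW L m n φ U hL αU hα1 hU1 hreg (c₀ := c₀) (c₁ := c₁)) (KinvLatticeK hposU hQU)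
        (covDerivL2K ℂ c₀ ((η : ℂ))⁻¹ (adTransportW φ U)) (RofUk L m n φ η U)
        (covDivL2K ℂ c₀ ((η : ℂ))⁻¹ (adTransportW φ fun b => (U b)⁻¹)) f
    have e2 : frakGLatticeCLM (L := (L : ℝ)) (η := η) (lev₀ := lev₀) φ hposV hQV lev₁ (nabla115 η V) f =
        toCLM115 (L := (L : ℝ)) (η := η) (lev₀ := lev₀) lev₁ (nabla115 η V)
          (readFun φ (fun _ => c₀) (fun _ => c₀) (frakGLatticeK hposV hQV)) f :=
      frakG_eq_toCLM115_readFun (L := (L : ℝ)) (η := η) (lev₀ := lev₀) φ lev₁ (nabla115 η V)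
        (G1LatticeK hposV) (QkW L m n φ V hL αV hα1' hV1 hregV (c₀ := c₀) (c₁ := c₁)) (KinvLatticeK hposV hQV)
        (covDerivL2K ℂ c₀ ((η : ℂ))⁻¹ (adTransportW φ V)) (RofUk L m n φ η V)
        (covDivL2K ℂ c₀ ((η : ℂ))⁻¹ (adTransportW φ fun b => (V b)⁻¹)) f
    rw [e1, e2]
    have h := norm_toCLM115_readFun_sub_le (L := (L : ℝ)) (η := η) (lev₀ := lev₀) φ hMφ hφ hMφ' hφ' lev₁ (nabla115 η V)
      (frakGLatticeK hposU hQU) (frakGLatticeK hposV hQV) hCδ hG hDV f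
    exact le_of_le_of_eq h (by ring)
  · have e1 : LinearMap.toContinuousLinearMap
            ((jetLinearEquiv (L : ℝ) η lev₀ lev₁ (nabla115 η V)).symm.toLinearMap ∘ₗ
              (jetLinearEquiv (L : ℝ) η lev₀ lev₁ (nabla115 η U)).toLinearMap)
            (H1LatticeCLM (L := (L : ℝ)) (η := η) (lev₀ := lev₀) (levB := levB) φ hposU hQU lev₁ (nabla115 η U) B) =
        H1CLM (L := (L : ℝ)) (η := η) (lev₀ := lev₀) (levB := levB) φ lev₁ (nabla115 η V) (H1LatticeK hposU hQU) B := rfl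
    have e2 : H1LatticeCLM (L := (L : ℝ)) (η := η) (lev₀ := lev₀) (levB := levB) φ hposV hQV lev₁ (nabla115 η V) B =
        H1CLM (L := (L : ℝ)) (η := η) (lev₀ := lev₀) (levB := levB) φ lev₁ (nabla115 η V) (H1LatticeK hposV hQV) B := rfl
    rw [e1, e2]
    have h := norm_H1CLM_sub_le (L := (L : ℝ)) (η := η) (lev₀ := lev₀) (levB := levB) φ hMφ hφ hMφ' hφ' lev₁ (nabla115 η V)
      (H1LatticeK hposU hQU) (H1LatticeK hposV hQV) hCδ hH hDV B
    exact le_of_le_of_eq h (by ring)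

end Literature.MathematicalPhysics.QuantumFieldTheory.Balaban1983to89.B11Eq117LetterDefectsTowerTwoBackgrounds

end
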